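import Literature.NumberTheory.ComplexMultiplication.FiniteQAlgebraLatticeMetricDual
import HarnessLib

/-!
# WEAK EQUIVALENCE of full lattices of an ARBITRARY finite-dimensional commutative `ℚ`-algebra `A`:
# `L_1 ∼_w L_2` ⟺ `1 ∈ (L_1:L_2)(L_2:L_1)` ⟺ `𝒪(L_1) = 𝒪(L_2)` and `L_2 = L_1L_3` with `L_3 ∈ G(𝒪(L_1))`, then
# `L_3 = L_2:L_1` is UNIQUE; `G(Λ) = [Λ]_w`; the bijection `G(𝒪(L_1)) → [L_1]_w`; `∼_w` is a congruence for products
# and the division map; `W(𝓛(A)) = W(𝓔(A))` (Hertling–Larabi 2026 Thm. 5.7, Thm. 5.8 (a)(b), Thm. 4.4 (a)(b) =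
# Dade–Taussky–Zassenhaus 1962); and the SEMIGROUPS `𝓛(A)`, `𝓔(A)`, `W(𝓛(A))`: `ε`-classes (Def. 5.4, Lemma 5.5),
# idempotents = ORDERS (Thm. 5.6 (a)(b)), invertibility and `e_L = 𝒪(L)` (Thm. 5.6 (c) (i)(ii)(iv), Thm. 4.4 (c)(d)),
# freeness of `G([Λ]_ε)` on the fibres of (5.13) (Marseglia Thm. 4.6) — nilpotents allowed

[topic NumberTheory/ComplexMultiplication] General-`A` series (namespace
`Literature.NumberTheory.ComplexMultiplication.FiniteQAlgebraLattice`), the general-`A` twin of the `Y = L_1 ⊕ ⋯ ⊕ L_t`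
file `CMAlgebraLatticeWeakEquivalence` (seat p19 gen 31), sequel of `FiniteQAlgebraLatticePowersInvertible` §4 (the
relation `1 ∈ (L_1:L_2)(L_2:L_1)` for general `A`: symmetric, transitive, compatible with products — REUSED by name:
`div_mul_div_le_div`, `one_mem_div_mul_div_comm`, `one_mem_div_mul_div_trans`,
`one_mem_div_order_mul_order_div_of_mul_div_div_eq`) and of `FiniteQAlgebraLatticeMetricDual` §3 (KRULL'S LEMMA for
general `A`, `one_mem_of_mul_le_of_mul_eq`, which is the only place where fullness and `ℚ` enter).  Lane
`lit-hodgefound` (Track 2 foundations library), seat p19 generation 36, rows g36-#4 (§0–§3) and g36-#5 (§4–§7, the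
general-`A` twins of the `Y`-file `CMAlgebraLatticeSemigroup` §4–§5).  THEOREMS ONLY: no definition, no
instance, no notation, no named fact (D-0026, net Literature debt `0`), no `sorry`.  Vocabulary: `IsFullLattice A M`,
`M·N`, `M:N = M / N`, `𝒪(M) = M / M`, invertibility `M·(𝒪(M):M) = 𝒪(M)`, `L_1 ∼_w L_2` written
`∃ L_3 L_4, L_1L_3 = L_2 ∧ L_2L_4 = L_1` or, equivalently (Thm. 5.7 (a)), `1 ∈ (L_1:L_2)(L_2:L_1)`; `ε`-classes by units
`u • M`, `u : Aˣ`.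

## Source, VERBATIM

C. Hertling, K. Larabi, *Semigroups from full lattices in commutative ℚ-algebras*, arXiv:2602.14973 (2026)
[HertlingLarabi2026], held `paper:arxiv-2602.14973`.  §4 (chunk p0009): «**Definition 4.3.** […] (b) Let `S` be a
commutative semigroup. Two elements `a_1` and `a_2 ∈ S` are `w`-equivalent (notation: `a_1 ∼_w a_2`), if the following
holds: `a_1 = a_2` or `∃ x_1, x_2 ∈ S` with `a_1x_1 = a_2, a_2x_2 = a_1`. […] **Theorem 4.4 (DTZ62).** Let `S` be a
commutative semigroup. (a) `∼_w` is an equivalence relation and is compatible with the multiplication in `S`, i.e.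
`a_1 ∼_w a_2, b_1 ∼_w b_2 ⟹ a_1b_1 ∼_w a_2b_2`. […] (b) If `a` is invertible then `[a]_w = G(e_a)`.»
§5 (chunk p0013): «**Theorem 5.7 (DTZ62).** (a) Let `L_1, L_2 ∈ 𝓛(A)`. The following four properties are equivalent.
(i) `L_1 ∼_w L_2`. (ii) `1 ∈ (L_1:L_2)(L_2:L_1)`. (iii) `𝒪(L_1) = 𝒪(L_2)` and `L_3 ∈ G(𝒪(L_1))` with `L_1L_3 = L_2`
exists. (iv) `[L_1]_ε ∼_w [L_2]_ε`. (b) Let `L_1, L_2 ∈ 𝓛(A)` with `L_1 ∼_w L_2`. We have `L_1:L_2 ∈ G(𝒪(L_1))`,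
`L_2:L_1 ∈ G(𝒪(L_1))`, `(L_1:L_2)⁻¹ = L_2:L_1`, `L_2 = (L_2:L_1)L_1`, `L_1 = (L_1:L_2)L_2`,
`𝒪(L_1) = 𝒪(L_2) = 𝒪(L_1:L_2) = 𝒪(L_2:L_1) = (L_1:L_2)(L_2:L_1)`. (c) `W(𝓛(A)) = W(𝓔(A))`, and this semigroup
inherits a division map from the division map on `𝓛(A)`. Proof: (a) (i)⟹(ii): Suppose `L_1 ∼_w L_2`. Then
`L_3, L_4 ∈ 𝓛(A)` with `L_1L_3 = L_2` and `L_2L_4 = L_1` exist. Especially `L_1(L_2:L_1) = L_2` and `L_2(L_1:L_2) = L_1`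
[…]. Lemma 5.2 (c) (Krull's lemma) can be applied and yields `1 ∈ (L_1:L_2)(L_2:L_1)`, because of the following two
calculations, `L_2(L_1:L_2)(L_2:L_1) = L_1(L_2:L_1) = L_2`, `((L_1:L_2)(L_2:L_1))² […] ⊂ (L_1:L_2)(L_2:L_1)(L_1:L_1)
= (L_1:L_2)(L_2:L_1)𝒪(L_1) = (L_1:L_2)(L_2:L_1)`. (ii)⟹(iii): Define `Λ := (L_1:L_2)(L_2:L_1)`. The last calculation
`ΛΛ ⊂ Λ` and the assumption `1 ∈ Λ` in (ii) show that `Λ` is an order. It contains `𝒪(L_1)` and `𝒪(L_2)` because of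
(5.3). It is contained in `L_1:L_1 = 𝒪(L_1)` and in `L_2:L_2 = 𝒪(L_2)` […]. Therefore `𝒪(L_1) = Λ = 𝒪(L_2)`. This is
also equal to `𝒪(L_1:L_2)` and `𝒪(L_2:L_1)` […]. With `Λ = (L_1:L_2)(L_2:L_1)` we obtain `L_1:L_2 ∈ G(Λ)`,
`L_2:L_1 ∈ G(Λ)` and `(L_1:L_2)⁻¹ = L_2:L_1`. Now `L_3 := L_2:L_1 ∈ G(Λ)` satisfies `L_2 = L_2Λ ⊂ L_1(L_2:L_1) ⊂ L_2`,
so `L_2 = L_1(L_2:L_1) = L_1L_3`. (iii)⟹(i): `L_1L_3 = L_2` and `L_2L_3⁻¹ = L_1L_3L_3⁻¹ = L_1𝒪(L_1) = L_1` show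
`L_1 ∼_w L_2`. (i)⟹(iv): Trivial. (iv)⟹(i): Suppose `[L_1]_ε[L_3]_ε = [L_2]_ε` and `[L_2]_ε[L_4]_ε = [L_1]_ε`. Then
`a_1, a_2 ∈ A^{unit}` with `a_1L_1L_3 = L_2` and `a_2L_2L_4 = L_1` exist. Thus `L_1 ∼_w L_2`. (b) This was shown in the
proof of (ii)⟹(iii) in part (a). (c) Suppose `L_1 ∼_ε L_2`. Then […] `a ∈ A^{unit}` with `aL_1 = L_2` exists. Then
`L_1a𝒪(L_1) = L_2` and `L_2a⁻¹𝒪(L_1) = L_1`, so `L_1 ∼_w L_2`. […] Finally, we want to show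
`L_3 ∼_w L_5, L_4 ∼_w L_6 ⟹ L_3:L_4 ∼_w L_5:L_6` (5.9). We calculate `L_3:L_4 ⊃ (L_3:L_5)(L_5:L_6)(L_6:L_4)
⊃ (L_3:L_5)(L_5:L_3)(L_3:L_4)(L_4:L_6)(L_6:L_4) = 𝒪(L_3)(L_3:L_4)𝒪(L_4) = (L_3:L_4)`, so
`L_3:L_4 = (L_5:L_6)((L_3:L_5)(L_6:L_4))`, and analogously `L_5:L_6 = (L_3:L_4)((L_5:L_3)(L_4:L_6))`. Therefore
`L_3:L_4 ∼_w L_5:L_6`. □ […] **Theorem 5.8.** (a) Let `L_1, L_2 ∈ 𝓛(A)` with `L_1 ∼_w L_2`. Then `𝒪(L_1) = 𝒪(L_2)`.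
The only full lattice `L_3` with `L_1L_3 = L_2` and `L_3 ∈ G(𝒪(L_1))` is `L_3 = L_2:L_1`. (b) Let `Λ` be an order and
`L_1 ∈ 𝓛(A)` with `𝒪(L_1) = Λ`. Then `G(Λ) = [Λ]_w` and `G([Λ]_ε) = [[Λ]_ε]_w` (5.11). The maps `G(Λ) → [L_1]_w`,
`L_3 ↦ L_3L_1` (5.12), `G([Λ]_ε) → [[L_1]_ε]_w`, `[L_3]_ε ↦ [L_3]_ε[L_1]_ε` (5.13), are well defined and bijections.
Proof: (a) […] Suppose `L_3 ∈ G(𝒪(L_1))` with `L_1L_3 = L_2`. Then `L_3 ⊂ L_2:L_1`. Also `L_1 = L_2L_3⁻¹` which implies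
`L_3⁻¹ ⊂ L_1:L_2`. This last inclusion implies `L_3 ⊃ (L_1:L_2)⁻¹ = L_2:L_1`. Therefore `L_3 = L_2:L_1`. (b) (5.11)
follows from Theorem 4.4 (b). […]»
§4 (chunks p0009–p0010) continued: «**Definition 4.1.** (b) Let `S` be a commutative semigroup. An element
`a ∈ S` is called invertible if an element `b ∈ S` and an element `c ∈ S` with `ab = c` and `ac = a` exist. (c) […]
An element `c ∈ S` is called idempotent if `cc = c`. […] **Theorem 4.4** (c) Let `a ∈ S`. The following three
properties are equivalent: (i) `a` is invertible. (ii) `[a]_w` is invertible (in `W(S)`). (iii) `[a]_w` is idempotent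
(in `W(S)`). The only subgroups of `W(S)` are the sets `{[c]_w}` with `c ∈ S` idempotent. (d) […] The subsemigroup
`W(⋃_{c idempotent} G(c))` of `W(S)` is isomorphic to the subsemigroup `{c ∈ S | c is idempotent}` of `S`. Proof: […]
(c) (i)⟹(iii): Because of (b), `[a]_w = [e_a]_w`. Because of (a), `[e_a]_w² = [e_a²]_w = [e_a]_w`. (iii)⟹(ii): An
idempotent element in a semigroup (here `W(S)`) is invertible […]. (ii)⟹(i): Let `b, c ∈ S` with `[a]_w[b]_w = [c]_w`
and `[c]_w[a]_w = [a]_w`. […] `x_1, y_1 ∈ S` with `(ab)x_1 = c` and `(ca)y_1 = a` exist, so `a(bx_1y_1) = cy_1` and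
`(cy_1)a = a`. This shows that then `a` is invertible with `e_a = cy_1`.»
§5 (chunks p0011–p0012): «**Definition 5.4.** (a) An equivalence relation `∼_ε` on `𝓛(A)` is defined as follows,
`L_1 ∼_ε L_2 :⟺ a ∈ A^{unit}` with `a·L_1 = L_2` exists. The equivalence class […] is called `ε`-class of `L` and is
denoted `[L]_ε`. […] **Lemma 5.5.** The multiplication of full lattices gives the structure of a commutative semigroup
on `𝓛(A)`. It induces the structure of a commutative semigroup on `𝓔(A)`. If `L_1 ∼_ε L_2`, then `𝒪(L_1) = 𝒪(L_2)`,
so the order `𝒪([L_1]_ε) := 𝒪(L_1)` is well defined. Also the division map `(L_1, L_2) ↦ L_1:L_2` on `𝓛(A)` induces a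
division map […] on `𝓔(A)`. Proof: […] Then `a_1a_2L_1L_2 = L_3L_4` and `(a_1a_2⁻¹)·(L_1:L_2) = L_3:L_4` […].
**Theorem 5.6 (DTZ62) [Fa65].** (a) `Λ ∈ 𝓛(A)` is an idempotent in the semigroup `𝓛(A)` if and only if it is an
order. (b) `[L]_ε` is an idempotent in the semigroup `𝓔(A)` if and only if the class `[L]_ε` contains an order. (c)
Let `L ∈ 𝓛(A)`. The following five properties are equivalent: (i) `L` is invertible in the semigroup `𝓛(A)`. (ii)
`L_2 ∈ 𝓛(A)` with `L·L_2 = 𝒪(L)` exists. (iii) `L·(𝒪(L):L) = 𝒪(L)`. (iv) `[L]_ε` is invertible in the semigroup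
`𝓔(A)`. (v) `𝒪(𝒪(L):L) = 𝒪(L)`. If this holds then `e_L = 𝒪(L)`, `L⁻¹ = 𝒪(L):L`, […] and
`e_{[L]_ε} = [𝒪(L)]_ε`, `[L]_ε⁻¹ = [L⁻¹]_ε`. Proof: (a) ⟸: Let `Λ` be an order. Because of `1 ∈ Λ`, we have
`ΛΛ = Λ` […]. ⟹: Let `Λ` be an idempotent, so `ΛΛ = Λ`. Lemma 5.2 (c) (Krull's lemma) for `Λ = L` shows `1 ∈ Λ`.
Therefore `Λ` is an order. (b) […] ⟹: Suppose `[L]_ε[L]_ε = [L]_ε`. Then `LL ∼_ε L`, so `a ∈ A^{unit}` with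
`aLL = L` exists. Then `(aL)² = (aL)`, and `aL ∈ [L]_ε` is an idempotent in `𝓛(A)`. By part (a), `aL` is an order.
(c) (i)⟹(ii): Let `L` be invertible in the semigroup `𝓛(A)`. Then `L_2` and `Λ ∈ 𝓛(A)` with `Λ` an order and
`LL_2 = Λ` and `ΛL = L` exist. The last condition says `Λ ⊂ 𝒪(L)`. Now `LL_2 = 𝒪(L)LL_2 = 𝒪(L)Λ = 𝒪(L)` (`=` and
not just `⊂` because of `1 ∈ Λ`). […] (iii)⟹(iv): `[L]_ε[𝒪(L):L]_ε = [L(𝒪(L):L)]_ε = [𝒪(L)]_ε` and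
`[𝒪(L)]_ε[L]_ε = [𝒪(L)L]_ε = [L]_ε`. (iv)⟹(i): Let `[L]_ε` be invertible in the semigroup `𝓔(A)` with
`e_{[L]_ε} = [Λ]_ε` with `Λ` an order. Then `[L]_ε = [L]_ε[Λ]_ε = [LΛ]_ε`, and `L_1 ∈ 𝓛(A)` with
`[L]_ε[L_1]_ε = [Λ]_ε` exists. Thus `a ∈ A^{unit}` with `aLL_1 = Λ` exists, so `Λ ⊃ 𝒪(L)`. Now `[L]_ε = [LΛ]_ε` shows
`Λ = 𝒪(L)`, so `L` is invertible in `𝓛(A)`.»  ((iii) ⟺ (ii) and (v) ⟺ (i) are `FiniteQAlgebraLatticePowersInvertible`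
§1 and `FiniteQAlgebraLatticeFaddeevCriterion`.)
S. Marseglia, *Computing the ideal class monoid of an order*, J. LMS (2) 101 (2020) [Marseglia2019], §4 (chunk p0009):
«**Theorem 4.6.** Let `R` be an order in `K`. For every over-order `S` of `R`, the action of `Pic(S)` on `ICM̄(S)`
induced by ideal multiplication is free and `W̄(S) = ICM̄(S)/Pic(S)`. […] Proof. […] To conclude, it is enough to
prove that if `I = IJ` with `I` and `J` both having multiplicator ring `S` and `J` invertible in `S`, then `J = S`.»

## What is formalised (`L_j, M, N, Λ : Submodule ℤ A`; §0–§1, §3 hold in any commutative ring unless a lattice is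
## assumed full — then `A` is a `ℚ`-algebra)

* §0 COLON CALCULUS: `div_mul_div_le_div_self` (`(L_1:L_2)(L_2:L_1) ⊆ 𝒪(L_1)`), `div_self_mul_div_eq`
  (`𝒪(A)(A:B) = A:B`), `div_mul_div_self_eq`, `div_self_div_div_self` (`𝒪(𝒪(L)) = 𝒪(L)`), `div_mul_div_le`
  (`(L_1:L_2)(L_3:L_4) ⊆ (L_1L_3):(L_2L_4)`), `mul_div_eq_of_mul_eq` (`L_1L_3 = L_2 ⟹ L_1(L_2:L_1) = L_2`),
  `one_mem_div_mul_div_of_eq_mul`, `eq_div_div_of_mul_eq_div_self` (`L_2 = L⁻¹` when `LL_2 = 𝒪(L)`, `𝒪(L)L_2 = L_2`),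
  `div_div_div_eq_self_of_mul_div_div_eq` (`(L⁻¹)⁻¹ = L`), `units_smul_mul` (`u(MN) = (uM)N`).
* §1 THEOREM 5.7 (a) (ii) ⟹ (iii) and (b) (no fullness): **`div_mul_div_eq_div_self_of_one_mem`**,
  **`div_self_eq_div_self_of_one_mem`**, **`div_mul_eq_of_one_mem`**, `div_self_div_eq_div_self_of_one_mem`,
  `div_mul_inv_eq_of_one_mem`, **`div_self_div_div_eq_of_one_mem`**, `one_mem_div_mul_div_of_invertible_mul_eq`
  ((iii) ⟹ (ii)), `one_mem_div_mul_div_iff_exists_invertible_mul_eq` ((ii) ⟺ (iii)).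
* §2 THEOREM 5.7 (a) (i) ⟹ (ii) BY KRULL'S LEMMA, full lattices of a `ℚ`-algebra:
  **`one_mem_div_mul_div_of_mul_eq_of_mul_eq`**, **`one_mem_div_mul_div_iff_exists_mul_eq`** ((i) ⟺ (ii)),
  `exists_units_smul_mul_eq_iff_exists_mul_eq` ((iv) ⟺ (i)).
* §3 THEOREM 4.4 (a) ∕ 5.7 (c): `one_mem_div_self_mul_div_self` (reflexive; symmetric and transitive are §4 of
  `FiniteQAlgebraLatticePowersInvertible`), `equivalence_one_mem_div_mul_div`, **`one_mem_div_mul_div_mul`** (products),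
  **`one_mem_div_mul_div_of_units_smul_eq`** (`W(𝓛(A)) = W(𝓔(A))`), `div_eq_div_mul_of_one_mem_of_one_mem` and
  **`one_mem_div_div_mul_div_div`** ((5.9), the division map); THEOREM 5.8 (a)(b) ∕ 4.4 (b):
  **`eq_div_of_invertible_mul_eq`** (uniqueness), **`one_mem_div_mul_div_order_iff`** (`G(Λ) = [Λ]_w`),
  `one_mem_div_mul_div_iff_of_invertible` (`[L_1]_w = G(𝒪(L_1))` for invertible `L_1`),
  **`one_mem_div_mul_div_iff_existsUnique`** (the bijection `G(𝒪(L_1)) → [L_1]_w`, `L_3 ↦ L_3L_1`).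
* §4 `ε`-CLASSES (Def. 5.4, Lemma 5.5; any commutative ring): `units_smul_mul_units_smul`
  (`(a_1L_1)(a_2L_2) = (a_1a_2)(L_1L_2)`), **`units_smul_div_units_smul`** (`(a_1L_1):(a_2L_2) = (a_1a_2⁻¹)(L_1:L_2)`),
  `div_units_smul`, **`div_self_units_smul`** (`𝒪(aL) = 𝒪(L)`), `units_smul_mul_div_div_eq` (`G(Λ)` is a union of
  `ε`-classes), **`units_smul_eq_div_self_of_units_smul_mul_eq`** (Marseglia Thm. 4.6: freeness),
  **`units_smul_eq_of_units_smul_mul_eq_mul`** ((5.13) injective), `one_mem_div_mul_div_iff_div_self_eq_of_invertible`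
  (Thm. 4.4 (d): on invertible lattices `∼_w` is equality of orders).
* §5 THEOREM 5.6 (a)(b), full lattices of a `ℚ`-algebra: **`mul_self_eq_iff_one_mem`** (idempotents of `𝓛(A)` =
  orders, by Krull's lemma), **`exists_units_smul_mul_self_eq_iff`** (idempotents of `𝓔(A)` = classes of orders).
* §6 THEOREM 5.6 (c) (i) ⟺ (ii) ⟺ (iv): **`eq_div_self_of_mul_eq_of_mul_eq`** (`e_L = 𝒪(L)`),
  **`exists_mul_eq_and_mul_eq_iff_exists_mul_eq_div_self`** ((i) ⟺ (ii)),
  `exists_units_smul_eq_div_self_of_units_smul_mul_eq` ((iv) ⟹ (ii) with `e_{[L]_ε} = [𝒪(L)]_ε`),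
  **`exists_units_smul_mul_eq_and_iff_exists_mul_eq_div_self`** ((iv) ⟺ (ii)).
* §7 THEOREM 4.4 (c): **`mul_div_div_eq_of_one_mem_div_mul_mul_div`** ((ii) ⟹ (i): `L ∼_w LLN ⟹ L` invertible, via
  the idempotent `E = LN(L:LLN)`), `exists_one_mem_div_mul_mul_div_iff` ((i) ⟺ (ii)),
  **`one_mem_div_mul_self_mul_div_iff`** ((i) ⟺ (iii): `L` invertible ⟺ `L ∼_w LL`).
NOT here: the `ε`-class-SET form of (5.13) and the class counts of the `Y`-file `CMAlgebraLatticeWeakEquivalence` §4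
(they need the `ε`-setoid; for general `A` the classes need not be finitely many), Thm. 5.6 (c) (v) (see
`FiniteQAlgebraLatticeFaddeevCriterion`).

## References
* [HertlingLarabi2026] C. Hertling, K. Larabi, arXiv:2602.14973 (2026), §4 Def. 4.3, Thm. 4.4 (chunks p0009–p0010);
  §4 Def. 4.1, Thm. 4.2, Thm. 4.4 (c)(d) (chunks p0009–p0010); §5 Lemma 5.2 (c), Lemma 5.3, Def. 5.4 (chunk
  p0011), Lemma 5.5, Thm. 5.6 (chunk p0012), Thm. 5.7, Thm. 5.8 (chunks p0013–p0014).
  [cite: HertlingLarabi2026, §5 Thm. 5.6, Thm. 5.7 and Thm. 5.8, chunks p0012–p0013]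
* [DadeTausskyZassenhaus1962] E. C. Dade, O. Taussky, H. Zassenhaus, Math. Ann. 148 (1962) 31–64 («(DTZ62)» of Thm.
  5.7; weak equivalence). [cite: DadeTausskyZassenhaus1962, §1 (as cited by HertlingLarabi2026 Thm. 5.7)]
* [Marseglia2019] S. Marseglia, J. LMS (2) 101 (2020) 984–1007, arXiv:1805.09671, §4 Prop. 4.1, Cor. 4.5, Thm. 4.6
  (the same statements for fractional ideals of an order in `∏ Lᵢ`). [cite: Marseglia2019, §4 Prop. 4.1, Cor. 4.5 and Thm. 4.6, chunks p0008–p0009]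
-/

noncomputable section

open scoped Pointwise
open Submodule Module
open Literature.NumberTheory.Automorphic (IsFullLattice mem_units_smul_submodule_iff)

namespace Literature.NumberTheory.ComplexMultiplication.FiniteQAlgebraLattice

/-! ## §0 Colon calculus in the commutative semiring `Submodule ℤ A` -/

section Colon

variable {A : Type} [CommRing A]

/-- **`(L_1:L_2)(L_2:L_1) ⊆ L_1:L_1 = 𝒪(L_1)`** («It is contained in `L_1:L_1 = 𝒪(L_1)` […] by definition of `L_1:L_2`
and `L_2:L_1`»). [cite: HertlingLarabi2026, §5 Thm. 5.7 (proof of (ii) ⟹ (iii)), chunk p0013] -/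
theorem div_mul_div_le_div_self (M N : Submodule ℤ A) : (M / N) * (N / M) ≤ M / M :=
  div_mul_div_le_div M N M

/-- **`𝒪(A)·(A:B) = (A:B)`** — the colon is an `𝒪(A)`-module (HL (5.3) `𝒪(L_1:L_2) ⊃ Λ_1Λ_2`).
[cite: HertlingLarabi2026, §5 Lemma 5.3 (b), chunk p0011] -/
theorem div_self_mul_div_eq (M N : Submodule ℤ A) : (M / M) * (M / N) = M / N := by
  refine le_antisymm (div_mul_div_le_div M M N) fun x hx => ?_
  rw [← one_mul x]
  exact Submodule.mul_mem_mul (one_mem_div_self M) hx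

/-- **`(A:B)·𝒪(B) = (A:B)`** — the colon is an `𝒪(B)`-module. [cite: HertlingLarabi2026, §5 Lemma 5.3 (b), chunk p0011] -/
theorem div_mul_div_self_eq (M N : Submodule ℤ A) : (M / N) * (N / N) = M / N := by
  refine le_antisymm (div_mul_div_le_div M N N) fun x hx => ?_
  rw [← mul_one x]
  exact Submodule.mul_mem_mul hx (one_mem_div_self N)

/-- **`𝒪(𝒪(L)) = 𝒪(L)`** (the order of the order `𝒪(L) ∋ 1`). [cite: HertlingLarabi2026, §1 Lemma 1.2 (a) and §5 Lemma 5.2 (a), chunks p0003, p0011] -/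
theorem div_self_div_div_self (M : Submodule ℤ A) : (M / M) / (M / M) = M / M :=
  div_self_eq_of_one_mem (one_mem_div_self M) (div_self_mul_div_self M).le

/-- **`(L_1:L_2)(L_3:L_4) ⊆ (L_1L_3):(L_2L_4)`** (Lemma 5.2 (b)). [cite: HertlingLarabi2026, §5 Lemma 5.2 (b), chunk p0011] -/
theorem div_mul_div_le (L₁ L₂ L₃ L₄ : Submodule ℤ A) : (L₁ / L₂) * (L₃ / L₄) ≤ (L₁ * L₃) / (L₂ * L₄) := by
  refine Submodule.mul_le.2 fun a ha c hc => Submodule.mem_div_iff_forall_mul_mem.2 fun y hy => ?_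
  refine Submodule.mul_induction_on hy (fun b hb d hd => ?_) (fun y₁ y₂ h₁ h₂ => ?_)
  · rw [mul_mul_mul_comm]
    exact Submodule.mul_mem_mul ((Submodule.mem_div_iff_forall_mul_mem.1 ha) b hb)
      ((Submodule.mem_div_iff_forall_mul_mem.1 hc) d hd)
  · rw [mul_add]
    exact Submodule.add_mem _ h₁ h₂

/-- `(L_2:L_1)·L_1 ⊆ L_2` (the definition of the colon). [cite: HertlingLarabi2026, §5 Lemma 5.2 (a), chunk p0011] -/
private theorem div_mul_le (L₁ L₂ : Submodule ℤ A) : (L₂ / L₁) * L₁ ≤ L₂ :=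
  Submodule.le_div_iff_mul_le.1 le_rfl

/-- **`L_1L_3 = L_2 ⟹ L_1·(L_2:L_1) = L_2`** («Especially `L_1(L_2:L_1) = L_2` … (and not just
`L_1(L_2:L_1) ⊂ L_2`)»). [cite: HertlingLarabi2026, §5 Thm. 5.7 (proof of (a) (i) ⟹ (ii)), chunk p0013] -/
theorem mul_div_eq_of_mul_eq {L₁ L₂ L₃ : Submodule ℤ A} (h : L₁ * L₃ = L₂) : L₁ * (L₂ / L₁) = L₂ := by
  refine le_antisymm (by rw [mul_comm]; exact div_mul_le L₁ L₂) ?_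
  have h3 : L₃ ≤ L₂ / L₁ := Submodule.le_div_iff_mul_le.2 (le_of_eq (by rw [mul_comm, h]))
  calc L₂ = L₁ * L₃ := h.symm
    _ ≤ L₁ * (L₂ / L₁) := mul_le_mul' le_rfl h3

/-- **(iii) ⟹ (i), unit-free form: `I = AJ`, `J = BI` and `1 ∈ AB` imply `1 ∈ (I:J)(J:I)`** (`A ⊆ I:J`, `B ⊆ J:I`).
[cite: HertlingLarabi2026, §5 Thm. 5.7 (a) (iii) ⟹ (i), chunk p0013] [cite: Marseglia2019, §4 Prop. 4.1 (c) ⟹ (b), chunk p0008] -/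
theorem one_mem_div_mul_div_of_eq_mul {I J P Q : Submodule ℤ A} (hI : P * J = I) (hJ : Q * I = J)
    (h1 : (1 : A) ∈ P * Q) : (1 : A) ∈ (I / J) * (J / I) :=
  mul_le_mul' (Submodule.le_div_iff_mul_le.2 hI.le) (Submodule.le_div_iff_mul_le.2 hJ.le) h1

/-- **`L⁻¹ = 𝒪(L):L` is determined: if `L·L_2 = 𝒪(L)` and `𝒪(L)·L_2 = L_2` then `L_2 = 𝒪(L):L`.**
[cite: HertlingLarabi2026, §5 Thm. 5.6 (c) («`L⁻¹ = 𝒪(L):L`»), chunk p0012] -/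
theorem eq_div_div_of_mul_eq_div_self {M L₂ : Submodule ℤ A} (hML₂ : M * L₂ = M / M)
    (hOL₂ : (M / M) * L₂ = L₂) : L₂ = (M / M) / M := by
  refine le_antisymm (Submodule.le_div_iff_mul_le.2 (by rw [mul_comm, hML₂])) fun x hx => ?_
  rw [Submodule.mem_div_iff_forall_mul_mem] at hx
  have h1 : (1 : A) ∈ M * L₂ := by rw [hML₂]; exact one_mem_div_self M
  have key : ∀ w ∈ M * L₂, x * w ∈ L₂ := fun w hw =>
    Submodule.mul_induction_on hw (fun m hm l hl => by
        rw [← mul_assoc]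
        exact hOL₂.le (Submodule.mul_mem_mul (hx m hm) hl))
      (fun y z hy hz => by rw [mul_add]; exact L₂.add_mem hy hz)
  simpa using key 1 h1

/-- **`(L⁻¹)⁻¹ = L` for an invertible `L`: `𝒪(L):(𝒪(L):L) = L`** («`L⁻¹` is invertible with `𝒪(L⁻¹) = 𝒪(L)`»).
[cite: HertlingLarabi2026, §5 Thm. 5.6 (c), chunk p0012] -/
theorem div_div_div_eq_self_of_mul_div_div_eq {M : Submodule ℤ A} (h : M * ((M / M) / M) = M / M) :
    (M / M) / ((M / M) / M) = M := by
  have hO : ((M / M) / M) / ((M / M) / M) = M / M := div_div_div_eq_of_mul_div_div_eq h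
  have h1 : ((M / M) / M) * M = ((M / M) / M) / ((M / M) / M) := by rw [hO, mul_comm, h]
  have h2 : (((M / M) / M) / ((M / M) / M)) * M = M := by rw [hO, div_self_mul_eq_self]
  have h3 := eq_div_div_of_mul_eq_div_self h1 h2
  rw [hO] at h3
  exact h3.symm

/-- **`u•(MN) = (u•M)N`** — the `ε`-classes are compatible with the product («`a_1a_2L_1L_2 = L_3L_4`»).
[cite: HertlingLarabi2026, §5 Lemma 5.5 (proof), chunk p0012] -/
theorem units_smul_mul (u : Aˣ) (M N : Submodule ℤ A) : u • (M * N) = (u • M) * N := by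
  refine le_antisymm (fun x hx => ?_) (Submodule.mul_le.2 fun m hm n hn => ?_)
  · rw [mem_units_smul_submodule_iff] at hx
    rw [← smul_inv_smul u x]
    refine Submodule.mul_induction_on hx (fun m hm n hn => ?_) (fun a b ha hb => ?_)
    · rw [Units.smul_def, ← smul_mul_assoc, ← Units.smul_def]
      exact Submodule.mul_mem_mul (Submodule.smul_mem_pointwise_smul _ _ _ hm) hn
    · rw [smul_add]
      exact Submodule.add_mem _ ha hb
  · rw [mem_units_smul_submodule_iff] at hm ⊢
    rw [Units.smul_def, ← smul_mul_assoc, ← Units.smul_def]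
    exact Submodule.mul_mem_mul hm hn

/-! ## §1 Theorem 5.7 (a) (ii) ⟹ (iii) and (b): consequences of `1 ∈ (L_1:L_2)(L_2:L_1)` -/

/-- **THEOREM 5.7 (b): `1 ∈ (L_1:L_2)(L_2:L_1)` ⟹ `(L_1:L_2)(L_2:L_1) = 𝒪(L_1)`** («`ΛΛ ⊂ Λ` and the assumption
`1 ∈ Λ` […] `𝒪(L_1) = Λ`»; no fullness hypothesis). [cite: HertlingLarabi2026, §5 Thm. 5.7 (a) (ii) ⟹ (iii) and (b), chunk p0013] -/
theorem div_mul_div_eq_div_self_of_one_mem {L₁ L₂ : Submodule ℤ A} (h : (1 : A) ∈ (L₁ / L₂) * (L₂ / L₁)) :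
    (L₁ / L₂) * (L₂ / L₁) = L₁ / L₁ := by
  refine le_antisymm (div_mul_div_le_div_self L₁ L₂) fun x hx => ?_
  have hx1 : x * 1 ∈ (L₁ / L₁) * ((L₁ / L₂) * (L₂ / L₁)) := Submodule.mul_mem_mul hx h
  rwa [mul_one, ← mul_assoc, div_self_mul_div_eq] at hx1

/-- **THEOREM 5.7 (a)(b): weakly equivalent lattices have THE SAME ORDER, `𝒪(L_1) = 𝒪(L_2)`.**
[cite: HertlingLarabi2026, §5 Thm. 5.7 (a) (ii) ⟹ (iii), chunk p0013] [cite: Marseglia2019, §4 Prop. 4.1 (b) ⟹ (c), chunk p0008] -/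
theorem div_self_eq_div_self_of_one_mem {L₁ L₂ : Submodule ℤ A} (h : (1 : A) ∈ (L₁ / L₂) * (L₂ / L₁)) :
    L₁ / L₁ = L₂ / L₂ := by
  have h' : (1 : A) ∈ (L₂ / L₁) * (L₁ / L₂) := by rwa [mul_comm]
  rw [← div_mul_div_eq_div_self_of_one_mem h, mul_comm, div_mul_div_eq_div_self_of_one_mem h']

/-- **THEOREM 5.7 (b): `1 ∈ (L_1:L_2)(L_2:L_1)` ⟹ `(L_2:L_1)·L_1 = L_2`** («`L_2 = L_2Λ ⊂ L_1(L_2:L_1) ⊂ L_2`»).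
[cite: HertlingLarabi2026, §5 Thm. 5.7 (b), chunk p0013] [cite: Marseglia2019, §4 Cor. 4.5, chunk p0008] -/
theorem div_mul_eq_of_one_mem {L₁ L₂ : Submodule ℤ A} (h : (1 : A) ∈ (L₁ / L₂) * (L₂ / L₁)) :
    (L₂ / L₁) * L₁ = L₂ := by
  refine le_antisymm (div_mul_le L₁ L₂) ?_
  have h' : (1 : A) ∈ (L₂ / L₁) * (L₁ / L₂) := by rwa [mul_comm]
  calc L₂ = (L₂ / L₂) * L₂ := (div_self_mul_eq_self L₂).symm
    _ = (L₂ / L₁) * ((L₁ / L₂) * L₂) := by rw [← div_mul_div_eq_div_self_of_one_mem h', mul_assoc]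
    _ ≤ (L₂ / L₁) * L₁ := mul_le_mul' le_rfl (div_mul_le L₂ L₁)

/-- **THEOREM 5.7 (b): `𝒪(L_1:L_2) = 𝒪(L_1)`** («`𝒪(L_1) ⊂ 𝒪(L_1:L_2) ⊂ 𝒪(Λ) = Λ`»).
[cite: HertlingLarabi2026, §5 Thm. 5.7 (b), chunk p0013] -/
theorem div_self_div_eq_div_self_of_one_mem {L₁ L₂ : Submodule ℤ A} (h : (1 : A) ∈ (L₁ / L₂) * (L₂ / L₁)) :
    (L₁ / L₂) / (L₁ / L₂) = L₁ / L₁ := by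
  refine le_antisymm (fun x hx => ?_) (Submodule.le_div_iff_mul_le.2 (div_self_mul_div_eq L₁ L₂).le)
  have hx' : x ∈ ((L₁ / L₂) * (L₂ / L₁)) / ((L₁ / L₂) * (L₂ / L₁)) :=
    Submodule.mem_div_iff_forall_mul_mem.2 fun y hy =>
      Submodule.mul_induction_on hy (fun a ha b hb => by
          rw [← mul_assoc]
          exact Submodule.mul_mem_mul ((Submodule.mem_div_iff_forall_mul_mem.1 hx) a ha) hb)
        (fun a b ha hb => by rw [mul_add]; exact Submodule.add_mem _ ha hb)
  rwa [div_mul_div_eq_div_self_of_one_mem h, div_self_div_div_self] at hx'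

/-- **THEOREM 5.7 (b): `L_1:L_2 ∈ G(𝒪(L_1))` — the colon of weakly equivalent lattices is INVERTIBLE.**
[cite: HertlingLarabi2026, §5 Thm. 5.7 (b), chunk p0013] [cite: Marseglia2019, §4 Cor. 4.5, chunk p0008] -/
theorem div_mul_inv_eq_of_one_mem {L₁ L₂ : Submodule ℤ A} (h : (1 : A) ∈ (L₁ / L₂) * (L₂ / L₁)) :
    (L₁ / L₂) * (((L₁ / L₂) / (L₁ / L₂)) / (L₁ / L₂)) = (L₁ / L₂) / (L₁ / L₂) :=
  mul_div_div_eq_of_exists_mul_eq_div_self ⟨L₂ / L₁, by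
    rw [div_mul_div_eq_div_self_of_one_mem h, div_self_div_eq_div_self_of_one_mem h]⟩

/-- **THEOREM 5.7 (b): `(L_1:L_2)⁻¹ = L_2:L_1`**, i.e. `𝒪(L_1):(L_1:L_2) = L_2:L_1`.
[cite: HertlingLarabi2026, §5 Thm. 5.7 (b), chunk p0013] -/
theorem div_self_div_div_eq_of_one_mem {L₁ L₂ : Submodule ℤ A} (h : (1 : A) ∈ (L₁ / L₂) * (L₂ / L₁)) :
    (L₁ / L₁) / (L₁ / L₂) = L₂ / L₁ := by
  have hO := div_self_div_eq_div_self_of_one_mem h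
  have h1 : (L₁ / L₂) * (L₂ / L₁) = (L₁ / L₂) / (L₁ / L₂) := by
    rw [hO]; exact div_mul_div_eq_div_self_of_one_mem h
  have h2 : ((L₁ / L₂) / (L₁ / L₂)) * (L₂ / L₁) = L₂ / L₁ := by
    rw [hO, div_self_eq_div_self_of_one_mem h]; exact div_self_mul_div_eq L₂ L₁
  have h3 := eq_div_div_of_mul_eq_div_self h1 h2
  rw [hO] at h3
  exact h3.symm

/-- **THEOREM 5.7 (a) (iii) ⟹ (ii): if `𝒪(L_3) = 𝒪(L_1)`, `L_3` is invertible and `L_1L_3 = L_2`, then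
`1 ∈ (L_1:L_2)(L_2:L_1)`** («`L_1L_3 = L_2` and `L_2L_3⁻¹ = L_1L_3L_3⁻¹ = L_1𝒪(L_1) = L_1`»; no fullness hypothesis).
[cite: HertlingLarabi2026, §5 Thm. 5.7 (a) (iii) ⟹ (i), chunk p0013] -/
theorem one_mem_div_mul_div_of_invertible_mul_eq {L₁ L₂ L₃ : Submodule ℤ A} (hO : L₃ / L₃ = L₁ / L₁)
    (hinv : L₃ * ((L₃ / L₃) / L₃) = L₃ / L₃) (h : L₁ * L₃ = L₂) : (1 : A) ∈ (L₁ / L₂) * (L₂ / L₁) := by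
  have h' : (1 : A) ∈ (L₂ / L₁) * (L₁ / L₂) := by
    refine one_mem_div_mul_div_of_eq_mul (P := L₃) (Q := (L₃ / L₃) / L₃) (by rw [mul_comm, h]) ?_
      (by rw [hinv]; exact one_mem_div_self L₃)
    rw [← h, mul_comm L₁ L₃, ← mul_assoc, mul_comm ((L₃ / L₃) / L₃) L₃, hinv, hO, div_self_mul_eq_self]
  rwa [mul_comm] at h'

/-- **THEOREM 5.7 (a) (ii) ⟺ (iii): `1 ∈ (L_1:L_2)(L_2:L_1)` iff `𝒪(L_1) = 𝒪(L_2)` and `L_2 = L_1L_3` for an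
INVERTIBLE `L_3` with `𝒪(L_3) = 𝒪(L_1)`** (`L_3 = L_2:L_1`; no fullness hypothesis either way).
[cite: HertlingLarabi2026, §5 Thm. 5.7 (a) (ii) ⟺ (iii), chunk p0013] -/
theorem one_mem_div_mul_div_iff_exists_invertible_mul_eq (L₁ L₂ : Submodule ℤ A) :
    (1 : A) ∈ (L₁ / L₂) * (L₂ / L₁) ↔
      L₁ / L₁ = L₂ / L₂ ∧ ∃ L₃ : Submodule ℤ A,
        L₃ / L₃ = L₁ / L₁ ∧ L₃ * ((L₃ / L₃) / L₃) = L₃ / L₃ ∧ L₁ * L₃ = L₂ := by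
  refine ⟨fun h => ⟨div_self_eq_div_self_of_one_mem h, L₂ / L₁, ?_, ?_, ?_⟩,
    fun ⟨_, L₃, hO, hinv, h⟩ => one_mem_div_mul_div_of_invertible_mul_eq hO hinv h⟩
  · have h' : (1 : A) ∈ (L₂ / L₁) * (L₁ / L₂) := by rwa [mul_comm]
    rw [div_self_div_eq_div_self_of_one_mem h', div_self_eq_div_self_of_one_mem h]
  · have h' : (1 : A) ∈ (L₂ / L₁) * (L₁ / L₂) := by rwa [mul_comm]
    exact div_mul_inv_eq_of_one_mem h'
  · rw [mul_comm]; exact div_mul_eq_of_one_mem h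

end Colon

/-! ## §2 Theorem 5.7 (a) (i) ⟹ (ii), by Krull's lemma (full lattices of a `ℚ`-algebra) -/

section Krull

variable {A : Type} [CommRing A] [Algebra ℚ A]

/-- **THEOREM 5.7 (a) (i) ⟹ (ii) [DTZ62] for general `A`: `L_1L_3 = L_2` and `L_2L_4 = L_1` for a FULL lattice `L_2`
imply `1 ∈ (L_1:L_2)(L_2:L_1)`** — Krull's lemma for `Λ = (L_1:L_2)(L_2:L_1)`: «`L_2(L_1:L_2)(L_2:L_1) = L_1(L_2:L_1)
= L_2`, `((L_1:L_2)(L_2:L_1))² ⊂ (L_1:L_2)(L_2:L_1)(L_1:L_1) = (L_1:L_2)(L_2:L_1)`».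
[cite: HertlingLarabi2026, §5 Thm. 5.7 (a) (i) ⟹ (ii), chunk p0013] [cite: DadeTausskyZassenhaus1962, §1 (as cited)] -/
theorem one_mem_div_mul_div_of_mul_eq_of_mul_eq {L₁ L₂ L₃ L₄ : Submodule ℤ A} (hL₂ : IsFullLattice A L₂)
    (h₃ : L₁ * L₃ = L₂) (h₄ : L₂ * L₄ = L₁) : (1 : A) ∈ (L₁ / L₂) * (L₂ / L₁) := by
  have hA : L₁ * (L₂ / L₁) = L₂ := mul_div_eq_of_mul_eq h₃
  have hB : L₂ * (L₁ / L₂) = L₁ := mul_div_eq_of_mul_eq h₄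
  refine one_mem_of_mul_le_of_mul_eq (Λ := (L₁ / L₂) * (L₂ / L₁)) ?_ hL₂ ?_
  · calc (L₁ / L₂) * (L₂ / L₁) * ((L₁ / L₂) * (L₂ / L₁))
          ≤ (L₁ / L₂) * (L₂ / L₁) * (L₁ / L₁) := mul_le_mul' le_rfl (div_mul_div_le_div_self L₁ L₂)
      _ = (L₁ / L₂) * ((L₂ / L₁) * (L₁ / L₁)) := mul_assoc _ _ _
      _ = (L₁ / L₂) * (L₂ / L₁) := by rw [div_mul_div_self_eq]
  · calc (L₁ / L₂) * (L₂ / L₁) * L₂ = (L₂ / L₁) * (L₂ * (L₁ / L₂)) := by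
          rw [mul_comm (L₁ / L₂) (L₂ / L₁), mul_assoc, mul_comm (L₁ / L₂) L₂]
      _ = L₂ := by rw [hB, mul_comm, hA]

/-- **THEOREM 5.7 (a) (i) ⟺ (ii) [DTZ62]: for FULL lattices, `L_1 ∼_w L_2` — full `L_3`, `L_4` with `L_1L_3 = L_2`,
`L_2L_4 = L_1` exist (the clause «`a_1 = a_2`» of Def. 4.3 (b) is the case `L_3 = L_4 = 𝒪(L_1)`) — iff
`1 ∈ (L_1:L_2)(L_2:L_1)`**; then `L_3 = L_2:L_1`, `L_4 = L_1:L_2` serve.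
[cite: HertlingLarabi2026, §5 Thm. 5.7 (a) (i) ⟺ (ii) and §4 Def. 4.3 (b), chunks p0013, p0009] -/
theorem one_mem_div_mul_div_iff_exists_mul_eq {L₁ L₂ : Submodule ℤ A} (hL₁ : IsFullLattice A L₁)
    (hL₂ : IsFullLattice A L₂) :
    (1 : A) ∈ (L₁ / L₂) * (L₂ / L₁) ↔
      ∃ L₃ L₄ : Submodule ℤ A, IsFullLattice A L₃ ∧ IsFullLattice A L₄ ∧ L₁ * L₃ = L₂ ∧ L₂ * L₄ = L₁ := by
  refine ⟨fun h => ⟨L₂ / L₁, L₁ / L₂, isFullLattice_div hL₂ hL₁, isFullLattice_div hL₁ hL₂, ?_, ?_⟩,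
    fun ⟨L₃, L₄, _, _, h₃, h₄⟩ => one_mem_div_mul_div_of_mul_eq_of_mul_eq hL₂ h₃ h₄⟩
  · rw [mul_comm]; exact div_mul_eq_of_one_mem h
  · have h' : (1 : A) ∈ (L₂ / L₁) * (L₁ / L₂) := by rwa [mul_comm]
    rw [mul_comm]; exact div_mul_eq_of_one_mem h'

omit [Algebra ℚ A] in
/-- **THEOREM 5.7 (a) (iv) ⟺ (i): `[L_1]_ε ∼_w [L_2]_ε` in `𝓔(A)` — `a_1(L_1L_3) = L_2`, `a_2(L_2L_4) = L_1` for units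
`a_1, a_2` — iff `L_1 ∼_w L_2` in `𝓛(A)`** (absorb the units: `a(L_1L_3) = L_1(aL_3)`).
[cite: HertlingLarabi2026, §5 Thm. 5.7 (a) (i) ⟺ (iv), chunk p0013] -/
theorem exists_units_smul_mul_eq_iff_exists_mul_eq (L₁ L₂ : Submodule ℤ A) :
    (∃ (L₃ L₄ : Submodule ℤ A) (a₁ a₂ : Aˣ), IsFullLattice A L₃ ∧ IsFullLattice A L₄ ∧
        a₁ • (L₁ * L₃) = L₂ ∧ a₂ • (L₂ * L₄) = L₁) ↔
      ∃ L₃ L₄ : Submodule ℤ A, IsFullLattice A L₃ ∧ IsFullLattice A L₄ ∧ L₁ * L₃ = L₂ ∧ L₂ * L₄ = L₁ := by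
  constructor
  · rintro ⟨L₃, L₄, a₁, a₂, hL₃, hL₄, h₃, h₄⟩
    refine ⟨a₁ • L₃, a₂ • L₄, hL₃.units_smul a₁, hL₄.units_smul a₂, ?_, ?_⟩
    · rw [mul_comm, ← units_smul_mul, mul_comm, h₃]
    · rw [mul_comm, ← units_smul_mul, mul_comm, h₄]
  · rintro ⟨L₃, L₄, hL₃, hL₄, h₃, h₄⟩
    exact ⟨L₃, L₄, 1, 1, hL₃, hL₄, by rw [one_smul, h₃], by rw [one_smul, h₄]⟩

end Krull

/-! ## §3 Theorem 4.4 (a)(b), Theorem 5.7 (c) and Theorem 5.8 (a)(b) -/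

section Congruence

variable {A : Type} [CommRing A]

/-- `∼_w` is REFLEXIVE: `1 = 1·1 ∈ 𝒪(L)𝒪(L)`. [cite: HertlingLarabi2026, §4 Thm. 4.4 (a), chunk p0009] -/
theorem one_mem_div_self_mul_div_self (M : Submodule ℤ A) : (1 : A) ∈ (M / M) * (M / M) := by
  rw [← one_mul (1 : A)]
  exact Submodule.mul_mem_mul (one_mem_div_self M) (one_mem_div_self M)

/-- **THEOREM 4.4 (a): weak equivalence is an EQUIVALENCE RELATION** on every family `{M | p M}` of lattices
(reflexive here; symmetric and transitive are `one_mem_div_mul_div_comm`, `one_mem_div_mul_div_trans` of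
`FiniteQAlgebraLatticePowersInvertible` §4). [cite: HertlingLarabi2026, §4 Thm. 4.4 (a), chunk p0009] -/
theorem equivalence_one_mem_div_mul_div (p : Submodule ℤ A → Prop) :
    Equivalence fun M N : {M : Submodule ℤ A // p M} =>
      (1 : A) ∈ ((M : Submodule ℤ A) / N) * ((N : Submodule ℤ A) / M) where
  refl M := one_mem_div_self_mul_div_self M.1
  symm h := (one_mem_div_mul_div_comm _ _).1 h
  trans h₁ h₂ := one_mem_div_mul_div_trans h₁ h₂

/-- **THEOREM 4.4 (a) (4.5): `∼_w` is COMPATIBLE WITH THE PRODUCT — `A_1 ∼_w A_2`, `B_1 ∼_w B_2 ⟹ A_1B_1 ∼_w A_2B_2`**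
(`(A_1:A_2)(B_1:B_2) ⊆ (A_1B_1):(A_2B_2)`), so `W(𝓛(A))` is a commutative semigroup.
[cite: HertlingLarabi2026, §4 Thm. 4.4 (a) (4.5), chunk p0009] -/
theorem one_mem_div_mul_div_mul {A₁ A₂ B₁ B₂ : Submodule ℤ A} (hA : (1 : A) ∈ (A₁ / A₂) * (A₂ / A₁))
    (hB : (1 : A) ∈ (B₁ / B₂) * (B₂ / B₁)) :
    (1 : A) ∈ ((A₁ * B₁) / (A₂ * B₂)) * ((A₂ * B₂) / (A₁ * B₁)) := by
  have h1 : (1 : A) * 1 ∈ ((A₁ / A₂) * (A₂ / A₁)) * ((B₁ / B₂) * (B₂ / B₁)) := Submodule.mul_mem_mul hA hB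
  rw [mul_one, mul_mul_mul_comm] at h1
  exact mul_le_mul' (div_mul_div_le A₁ A₂ B₁ B₂) (div_mul_div_le A₂ A₁ B₂ B₁) h1

/-- **THEOREM 5.7 (c), `W(𝓛(A)) = W(𝓔(A))`: `ε`-equivalent lattices are weakly equivalent — `uL_1 = L_2 ⟹
1 = u⁻¹·u ∈ (L_1:L_2)(L_2:L_1)`** («`L_1a𝒪(L_1) = L_2` and `L_2a⁻¹𝒪(L_1) = L_1`, so `L_1 ∼_w L_2`»).
[cite: HertlingLarabi2026, §5 Thm. 5.7 (c), chunk p0013] -/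
theorem one_mem_div_mul_div_of_units_smul_eq {L₁ L₂ : Submodule ℤ A} {u : Aˣ} (h : u • L₁ = L₂) :
    (1 : A) ∈ (L₁ / L₂) * (L₂ / L₁) := by
  have h1 : ((u⁻¹ : Aˣ) : A) ∈ L₁ / L₂ := Submodule.mem_div_iff_forall_mul_mem.2 fun y hy => by
    rw [← h, mem_units_smul_submodule_iff] at hy
    rwa [Units.smul_def, smul_eq_mul] at hy
  have h2 : ((u : Aˣ) : A) ∈ L₂ / L₁ := Submodule.mem_div_iff_forall_mul_mem.2 fun y hy => by
    rw [← h, mem_units_smul_submodule_iff, Units.smul_def, smul_eq_mul, ← mul_assoc, Units.inv_mul, one_mul]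
    exact hy
  have h3 := Submodule.mul_mem_mul h1 h2
  rwa [Units.inv_mul] at h3

/-- **THEOREM 5.7 (c) (5.9), explicit form: `L_3 ∼_w L_5`, `L_4 ∼_w L_6 ⟹ L_3:L_4 = (L_5:L_6)·((L_3:L_5)(L_6:L_4))`**
(«`L_3:L_4 ⊃ (L_3:L_5)(L_5:L_6)(L_6:L_4) ⊃ (L_3:L_5)(L_5:L_3)(L_3:L_4)(L_4:L_6)(L_6:L_4) = 𝒪(L_3)(L_3:L_4)𝒪(L_4) =
(L_3:L_4)`»). [cite: HertlingLarabi2026, §5 Thm. 5.7 (c) (proof of (5.9)), chunk p0013] -/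
theorem div_eq_div_mul_of_one_mem_of_one_mem {L₃ L₄ L₅ L₆ : Submodule ℤ A}
    (h₃₅ : (1 : A) ∈ (L₃ / L₅) * (L₅ / L₃)) (h₄₆ : (1 : A) ∈ (L₄ / L₆) * (L₆ / L₄)) :
    L₃ / L₄ = (L₅ / L₆) * ((L₃ / L₅) * (L₆ / L₄)) := by
  have hup : (L₅ / L₆) * ((L₃ / L₅) * (L₆ / L₄)) ≤ L₃ / L₄ :=
    calc (L₅ / L₆) * ((L₃ / L₅) * (L₆ / L₄)) = ((L₃ / L₅) * (L₅ / L₆)) * (L₆ / L₄) := by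
          rw [mul_left_comm, mul_assoc]
      _ ≤ (L₃ / L₆) * (L₆ / L₄) := mul_le_mul' (div_mul_div_le_div L₃ L₅ L₆) le_rfl
      _ ≤ L₃ / L₄ := div_mul_div_le_div L₃ L₆ L₄
  refine le_antisymm ?_ hup
  calc L₃ / L₄ = (L₃ / L₃) * (L₃ / L₄) * (L₄ / L₄) := by rw [div_self_mul_div_eq, div_mul_div_self_eq]
    _ = ((L₃ / L₅) * (L₅ / L₃)) * (L₃ / L₄) * ((L₄ / L₆) * (L₆ / L₄)) := by
        rw [div_mul_div_eq_div_self_of_one_mem h₃₅, div_mul_div_eq_div_self_of_one_mem h₄₆]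
    _ = ((L₅ / L₃) * (L₃ / L₄) * (L₄ / L₆)) * ((L₃ / L₅) * (L₆ / L₄)) := by ring
    _ ≤ (L₅ / L₆) * ((L₃ / L₅) * (L₆ / L₄)) := by
        refine mul_le_mul' ?_ le_rfl
        calc (L₅ / L₃) * (L₃ / L₄) * (L₄ / L₆) ≤ (L₅ / L₄) * (L₄ / L₆) :=
              mul_le_mul' (div_mul_div_le_div L₅ L₃ L₄) le_rfl
          _ ≤ L₅ / L₆ := div_mul_div_le_div L₅ L₄ L₆

/-- **THEOREM 5.7 (c) (5.9): `∼_w` is COMPATIBLE WITH THE DIVISION MAP — `L_3 ∼_w L_5`, `L_4 ∼_w L_6 ⟹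
L_3:L_4 ∼_w L_5:L_6`** (multipliers `(L_3:L_5)(L_6:L_4)` and `(L_5:L_3)(L_4:L_6)`, whose product is `𝒪(L_3)𝒪(L_4) ∋ 1`).
[cite: HertlingLarabi2026, §5 Thm. 5.7 (c) (5.9), chunk p0013] -/
theorem one_mem_div_div_mul_div_div {L₃ L₄ L₅ L₆ : Submodule ℤ A} (h₃₅ : (1 : A) ∈ (L₃ / L₅) * (L₅ / L₃))
    (h₄₆ : (1 : A) ∈ (L₄ / L₆) * (L₆ / L₄)) :
    (1 : A) ∈ ((L₃ / L₄) / (L₅ / L₆)) * ((L₅ / L₆) / (L₃ / L₄)) := by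
  have h₅₃ : (1 : A) ∈ (L₅ / L₃) * (L₃ / L₅) := by rwa [mul_comm]
  have h₆₄ : (1 : A) ∈ (L₆ / L₄) * (L₄ / L₆) := by rwa [mul_comm]
  refine one_mem_div_mul_div_of_eq_mul (P := (L₃ / L₅) * (L₆ / L₄)) (Q := (L₅ / L₃) * (L₄ / L₆)) ?_ ?_ ?_
  · rw [mul_comm]; exact (div_eq_div_mul_of_one_mem_of_one_mem h₃₅ h₄₆).symm
  · rw [mul_comm]; exact (div_eq_div_mul_of_one_mem_of_one_mem h₅₃ h₆₄).symm
  · have h1 : (1 : A) * 1 ∈ ((L₃ / L₅) * (L₅ / L₃)) * ((L₆ / L₄) * (L₄ / L₆)) := Submodule.mul_mem_mul h₃₅ h₆₄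
    rwa [mul_one, mul_mul_mul_comm] at h1

/-- **THEOREM 5.8 (a), UNIQUENESS: if `𝒪(L_3) = 𝒪(L_1)`, `L_3` is invertible and `L_1L_3 = L_2`, then `L_3 = L_2:L_1`**
(«`L_3 ⊂ L_2:L_1`. Also `L_1 = L_2L_3⁻¹` which implies `L_3⁻¹ ⊂ L_1:L_2`. This last inclusion implies
`L_3 ⊃ (L_1:L_2)⁻¹ = L_2:L_1`»; no fullness hypothesis). [cite: HertlingLarabi2026, §5 Thm. 5.8 (a), chunk p0013] -/
theorem eq_div_of_invertible_mul_eq {L₁ L₂ L₃ : Submodule ℤ A} (hO : L₃ / L₃ = L₁ / L₁)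
    (hinv : L₃ * ((L₃ / L₃) / L₃) = L₃ / L₃) (h : L₁ * L₃ = L₂) : L₃ = L₂ / L₁ := by
  have hw : (1 : A) ∈ (L₁ / L₂) * (L₂ / L₁) := one_mem_div_mul_div_of_invertible_mul_eq hO hinv h
  refine le_antisymm (Submodule.le_div_iff_mul_le.2 (le_of_eq (by rw [mul_comm, h]))) ?_
  -- `L_3⁻¹ ⊆ L_1:L_2`
  have hinvle : (L₃ / L₃) / L₃ ≤ L₁ / L₂ := Submodule.le_div_iff_mul_le.2 (le_of_eq (by
    rw [← h, mul_comm L₁ L₃, ← mul_assoc, mul_comm ((L₃ / L₃) / L₃) L₃, hinv, hO, div_self_mul_eq_self]))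
  -- `L_2:L_1 = 𝒪(L_1):(L_1:L_2) ⊆ 𝒪(L_3):L_3⁻¹ = L_3`
  rw [← div_self_div_div_eq_of_one_mem hw, ← hO]
  calc (L₃ / L₃) / (L₁ / L₂) ≤ (L₃ / L₃) / ((L₃ / L₃) / L₃) := fun x hx =>
        Submodule.mem_div_iff_forall_mul_mem.2 fun y hy => (Submodule.mem_div_iff_forall_mul_mem.1 hx) y (hinvle hy)
    _ = L₃ := div_div_div_eq_self_of_mul_div_div_eq hinv

/-- **THEOREM 5.8 (b) (5.11) ∕ THEOREM 4.4 (b): `G(Λ) = [Λ]_w` — for an ORDER `Λ` (`1 ∈ Λ`, `ΛΛ ⊆ Λ`) a lattice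
`M` is weakly equivalent to `Λ` iff `𝒪(M) = Λ` and `M` is invertible** (no fullness hypothesis).
[cite: HertlingLarabi2026, §5 Thm. 5.8 (b) (5.11) and §4 Thm. 4.4 (b), chunks p0013, p0009] -/
theorem one_mem_div_mul_div_order_iff {Λ M : Submodule ℤ A} (h1 : (1 : A) ∈ Λ) (hΛ : Λ * Λ ≤ Λ) :
    (1 : A) ∈ (M / Λ) * (Λ / M) ↔ M / M = Λ ∧ M * ((M / M) / M) = M / M := by
  have hΛO : Λ / Λ = Λ := div_self_eq_of_one_mem h1 hΛ
  constructor
  · intro h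
    have hO : M / M = Λ := by rw [div_self_eq_div_self_of_one_mem h, hΛO]
    -- `M:Λ = M` as `𝒪(M) = Λ`
    have hMΛ : M / Λ = M := by
      refine le_antisymm (fun x hx => ?_) (Submodule.le_div_iff_mul_le.2 (le_of_eq ?_))
      · simpa using (Submodule.mem_div_iff_forall_mul_mem.1 hx) 1 h1
      · rw [← hO, mul_comm, div_self_mul_eq_self]
    refine ⟨hO, ?_⟩
    have hinv := div_mul_inv_eq_of_one_mem h
    rwa [hMΛ] at hinv
  · rintro ⟨hO, hinv⟩
    refine one_mem_div_mul_div_of_eq_mul (P := M) (Q := (M / M) / M) ?_ ?_ (by rw [hinv, hO]; exact h1)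
    · rw [mul_comm, ← hO, div_self_mul_eq_self]
    · rw [mul_comm, hinv, hO]

/-- **THEOREM 4.4 (b): `[L_1]_w = G(𝒪(L_1))` for an INVERTIBLE `L_1`** — `L_2 ∼_w L_1` iff `𝒪(L_2) = 𝒪(L_1)` and `L_2`
is invertible (through `L_1 ∼_w 𝒪(L_1)` and transitivity). [cite: HertlingLarabi2026, §4 Thm. 4.4 (b), chunks p0009–p0010] -/
theorem one_mem_div_mul_div_iff_of_invertible {L₁ L₂ : Submodule ℤ A} (hinv : L₁ * ((L₁ / L₁) / L₁) = L₁ / L₁) :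
    (1 : A) ∈ (L₂ / L₁) * (L₁ / L₂) ↔ L₂ / L₂ = L₁ / L₁ ∧ L₂ * ((L₂ / L₂) / L₂) = L₂ / L₂ := by
  have h1O := one_mem_div_self L₁
  have hOO := (div_self_mul_div_self L₁).le
  have hL₁ : (1 : A) ∈ (L₁ / (L₁ / L₁)) * ((L₁ / L₁) / L₁) := (one_mem_div_mul_div_order_iff h1O hOO).2 ⟨rfl, hinv⟩
  rw [← one_mem_div_mul_div_order_iff (M := L₂) h1O hOO]
  exact ⟨fun h => one_mem_div_mul_div_trans h hL₁,
    fun h => one_mem_div_mul_div_trans h ((one_mem_div_mul_div_comm _ _).1 hL₁)⟩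

/-- **THEOREM 5.8 (b) (5.12): the map `G(𝒪(L_1)) → [L_1]_w`, `L_3 ↦ L_3L_1`, is a BIJECTION — `L_2 ∼_w L_1` iff there
is a UNIQUE invertible `L_3` with `𝒪(L_3) = 𝒪(L_1)` and `L_3L_1 = L_2`** (well defined: (iii) ⟹ (ii); surjective:
(ii) ⟹ (iii); injective: Thm. 5.8 (a); no fullness hypothesis). [cite: HertlingLarabi2026, §5 Thm. 5.8 (b) (5.12), chunks p0013–p0014] -/
theorem one_mem_div_mul_div_iff_existsUnique (L₁ L₂ : Submodule ℤ A) :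
    (1 : A) ∈ (L₂ / L₁) * (L₁ / L₂) ↔
      ∃! L₃ : Submodule ℤ A, (L₃ / L₃ = L₁ / L₁ ∧ L₃ * ((L₃ / L₃) / L₃) = L₃ / L₃) ∧ L₃ * L₁ = L₂ := by
  rw [one_mem_div_mul_div_comm, one_mem_div_mul_div_iff_exists_invertible_mul_eq]
  constructor
  · rintro ⟨-, L₃, hO, hinv, h⟩
    refine ⟨L₃, ⟨⟨hO, hinv⟩, by rw [mul_comm, h]⟩, fun L₃' ⟨⟨hO', hinv'⟩, h'⟩ => ?_⟩
    exact (eq_div_of_invertible_mul_eq hO' hinv' (by rw [mul_comm, h'])).trans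
      (eq_div_of_invertible_mul_eq hO hinv h).symm
  · rintro ⟨L₃, ⟨⟨hO, hinv⟩, h⟩, -⟩
    have h' : L₁ * L₃ = L₂ := by rw [mul_comm, h]
    exact ⟨div_self_eq_div_self_of_one_mem (one_mem_div_mul_div_of_invertible_mul_eq hO hinv h'), L₃, hO, hinv, h'⟩

end Congruence

/-! ## §4 `ε`-classes (Definition 5.4, Lemma 5.5): units act compatibly with products, colons, orders and `G(Λ)` -/

section Epsilon

variable {A : Type} [CommRing A]

/-- `u(PQ) = P(uQ)` (file-local). [folklore] -/
private theorem units_smul_mul_right (u : Aˣ) (P Q : Submodule ℤ A) : u • (P * Q) = P * (u • Q) := by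
  rw [mul_comm P (u • Q), ← units_smul_mul, mul_comm]

/-- **LEMMA 5.5, the product descends to `𝓔(A)`: `(a_1L_1)(a_2L_2) = (a_1a_2)(L_1L_2)`** («Then
`a_1a_2L_1L_2 = L_3L_4`»). [cite: HertlingLarabi2026, §5 Lemma 5.5 (proof), chunk p0012] -/
theorem units_smul_mul_units_smul (u v : Aˣ) (M N : Submodule ℤ A) : (u • M) * (v • N) = (u * v) • (M * N) := by
  rw [← units_smul_mul, mul_comm M (v • N), ← units_smul_mul, mul_comm N M, ← mul_smul]

/-- **LEMMA 5.5, the division map descends to `𝓔(A)`: `(a_1L_1):(a_2L_2) = (a_1a_2⁻¹)(L_1:L_2)`** («and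
`(a_1a_2⁻¹)·(L_1:L_2) = L_3:L_4`, so `L_1L_2 ∼_ε L_3L_4` and `L_1:L_2 ∼_ε L_3:L_4`»).
[cite: HertlingLarabi2026, §5 Lemma 5.5 (proof), chunk p0012] -/
theorem units_smul_div_units_smul (u v : Aˣ) (M N : Submodule ℤ A) :
    (u • M) / (v • N) = (u * v⁻¹) • (M / N) := by
  ext x
  rw [Submodule.mem_div_iff_forall_mul_mem, mem_units_smul_submodule_iff, Submodule.mem_div_iff_forall_mul_mem]
  constructor
  · intro h y hy
    have h1 := h (v • y) (Submodule.smul_mem_pointwise_smul _ _ _ hy)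
    rw [mem_units_smul_submodule_iff] at h1
    have h2 : (u⁻¹ : Aˣ) • (x * v • y) = (u * v⁻¹)⁻¹ • x * y := by
      rw [mul_inv_rev, inv_inv, Units.smul_def, Units.smul_def, Units.smul_def, smul_eq_mul, smul_eq_mul,
        smul_eq_mul, Units.val_mul]
      ring
    rwa [h2] at h1
  · intro h y hy
    rw [mem_units_smul_submodule_iff] at hy ⊢
    have h1 := h _ hy
    have h2 : (u * v⁻¹)⁻¹ • x * (v⁻¹ : Aˣ) • y = (u⁻¹ : Aˣ) • (x * y) := by
      rw [mul_inv_rev, inv_inv, Units.smul_def, Units.smul_def, Units.smul_def, smul_eq_mul, smul_eq_mul,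
        smul_eq_mul, Units.val_mul]
      calc (v : A) * ↑u⁻¹ * x * (↑v⁻¹ * y) = (v : A) * ↑v⁻¹ * (↑u⁻¹ * (x * y)) := by ring
        _ = ↑u⁻¹ * (x * y) := by rw [Units.mul_inv, one_mul]
    rwa [h2] at h1

/-- `M:(aN) = a⁻¹(M:N)` (`units_smul_div_units_smul` with the first unit `1`).
[cite: HertlingLarabi2026, §5 Lemma 5.5 (proof), chunk p0012] -/
theorem div_units_smul (u : Aˣ) (M N : Submodule ℤ A) : M / (u • N) = u⁻¹ • (M / N) := by
  have h := units_smul_div_units_smul 1 u M N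
  rwa [one_smul, one_mul] at h

/-- **LEMMA 5.5: `𝒪(aL) = 𝒪(L)`** («If `L_1 ∼_ε L_2`, then `𝒪(L_1) = 𝒪(L_2)`, so the order `𝒪([L_1]_ε) := 𝒪(L_1)` is
well defined»). [cite: HertlingLarabi2026, §5 Lemma 5.5, chunk p0012] -/
theorem div_self_units_smul (u : Aˣ) (M : Submodule ℤ A) : (u • M) / (u • M) = M / M := by
  rw [units_smul_div_units_smul, mul_inv_cancel, one_smul]

/-- **`G(Λ)` is a union of `ε`-classes: `aL` is invertible when `L` is** (and `𝒪(aL) = 𝒪(L)`), so `G(Λ)` descends to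
the group `G([Λ]_ε)` of `𝓔(A)` («(iii)⟹(iv): `[L]_ε[𝒪(L):L]_ε = [L(𝒪(L):L)]_ε = [𝒪(L)]_ε` and
`[𝒪(L)]_ε[L]_ε = [𝒪(L)L]_ε = [L]_ε`»). [cite: HertlingLarabi2026, §5 Thm. 5.6 (c) (iii) ⟹ (iv), chunk p0012] -/
theorem units_smul_mul_div_div_eq (u : Aˣ) {M : Submodule ℤ A} (h : M * ((M / M) / M) = M / M) :
    (u • M) * (((u • M) / (u • M)) / (u • M)) = (u • M) / (u • M) := by
  rw [div_self_units_smul, div_units_smul, units_smul_mul_units_smul, mul_inv_cancel, one_smul, h]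

/-- **MARSEGLIA THM. 4.6, FREENESS at lattice level: `a(L_3L_1) = L_1` with `L_3 ∈ G(𝒪(L_1))` forces
`aL_3 = 𝒪(L_1)`** («if `I = IJ` with `I` and `J` both having multiplicator ring `S` and `J` invertible in `S`, then
`J = S`»; by the UNIQUENESS of Thm. 5.8 (a), `eq_div_of_invertible_mul_eq`: `aL_3` and `𝒪(L_1)` both solve `L_1·X = L_1`
in `G(𝒪(L_1))`) — the action of `G([𝒪(L_1)]_ε)` on the `ε`-classes weakly equivalent to `L_1` is FREE.
[cite: Marseglia2019, §4 Thm. 4.6, chunk p0009] [cite: HertlingLarabi2026, §5 Thm. 5.8 (a), chunk p0013] -/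
theorem units_smul_eq_div_self_of_units_smul_mul_eq {L₁ L₃ : Submodule ℤ A} {u : Aˣ} (hO : L₃ / L₃ = L₁ / L₁)
    (hinv : L₃ * ((L₃ / L₃) / L₃) = L₃ / L₃) (h : u • (L₃ * L₁) = L₁) : u • L₃ = L₁ / L₁ := by
  have hO' : (u • L₃) / (u • L₃) = L₁ / L₁ := by rw [div_self_units_smul, hO]
  have h' : L₁ * (u • L₃) = L₁ := by rw [mul_comm, ← units_smul_mul, h]
  exact eq_div_of_invertible_mul_eq hO' (units_smul_mul_div_div_eq u hinv) h'

/-- **THEOREM 5.8 (b) (5.13), INJECTIVITY at lattice level: `a(L_3L_1) = L_3'L_1` for `L_3, L_3' ∈ G(𝒪(L_1))` forces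
`aL_3 = L_3'`** — the map `G([𝒪(L_1)]_ε) → [[L_1]_ε]_w`, `[L_3]_ε ↦ [L_3]_ε[L_1]_ε`, is injective (both `aL_3` and
`L_3'` solve `L_1·X = L_3'L_1` in `G(𝒪(L_1))`: uniqueness, Thm. 5.8 (a)); it is well defined by `units_smul_mul` and
`one_mem_div_mul_div_of_invertible_mul_eq`, and surjective by Thm. 5.7 (a) (ii) ⟹ (iii)
(`one_mem_div_mul_div_iff_exists_invertible_mul_eq`: `M = L_1(M:L_1)` with `M:L_1 ∈ G(𝒪(L_1))`) («The map in (5.13)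
is bijective because the map in (5.12) is bijective and because it respects `ε`-classes»).
[cite: HertlingLarabi2026, §5 Thm. 5.8 (b) (5.13), chunks p0013–p0014] [cite: Marseglia2019, §4 Thm. 4.6, chunk p0009] -/
theorem units_smul_eq_of_units_smul_mul_eq_mul {L₁ L₃ L₃' : Submodule ℤ A} {u : Aˣ} (hO : L₃ / L₃ = L₁ / L₁)
    (hinv : L₃ * ((L₃ / L₃) / L₃) = L₃ / L₃) (hO' : L₃' / L₃' = L₁ / L₁)
    (hinv' : L₃' * ((L₃' / L₃') / L₃') = L₃' / L₃') (h : u • (L₃ * L₁) = L₃' * L₁) : u • L₃ = L₃' := by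
  have huO : (u • L₃) / (u • L₃) = L₁ / L₁ := by rw [div_self_units_smul, hO]
  have hu' : L₁ * (u • L₃) = L₃' * L₁ := by rw [mul_comm, ← units_smul_mul, h]
  exact (eq_div_of_invertible_mul_eq huO (units_smul_mul_div_div_eq u hinv) hu').trans
    (eq_div_of_invertible_mul_eq hO' hinv' (mul_comm L₁ L₃')).symm

/-- **THEOREM 4.4 (d) ∕ THEOREM 4.2 (f) at lattice level: on INVERTIBLE lattices weak equivalence is EQUALITY OF
ORDERS — for invertible `L_1, L_2`: `L_1 ∼_w L_2 ⟺ 𝒪(L_1) = 𝒪(L_2)`** («The subsemigroup `W(⋃_{c idempotent} G(c))`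
of `W(S)` is isomorphic to the subsemigroup `{c ∈ S | c is idempotent}` of `S`»; the idempotents of `𝓛(A)` are the
orders, Thm. 5.6 (a); via `[L_1]_w = G(𝒪(L_1))`, Thm. 4.4 (b)). [cite: HertlingLarabi2026, §4 Thm. 4.4 (d), Thm. 4.4 (b) and Thm. 4.2 (f), chunks p0009–p0010] -/
theorem one_mem_div_mul_div_iff_div_self_eq_of_invertible {L₁ L₂ : Submodule ℤ A}
    (h₁ : L₁ * ((L₁ / L₁) / L₁) = L₁ / L₁) (h₂ : L₂ * ((L₂ / L₂) / L₂) = L₂ / L₂) :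
    (1 : A) ∈ (L₁ / L₂) * (L₂ / L₁) ↔ L₁ / L₁ = L₂ / L₂ := by
  rw [one_mem_div_mul_div_comm, one_mem_div_mul_div_iff_of_invertible h₁]
  exact ⟨fun h => h.1.symm, fun h => ⟨h.symm, h₂⟩⟩

end Epsilon

/-! ## §5 Theorem 5.6 (a)(b): the idempotents of `𝓛(A)` are the orders, those of `𝓔(A)` the classes of orders -/

section Semigroup

variable {A : Type} [CommRing A] [Algebra ℚ A]

/-- **THEOREM 5.6 (a) [DTZ62]: a full lattice `Λ` is an IDEMPOTENT of `𝓛(A)` (`ΛΛ = Λ`) iff it is an ORDER (`1 ∈ Λ`,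
`ΛΛ ⊆ Λ`)** — «⟹: Let `Λ` be an idempotent, so `ΛΛ = Λ`. Lemma 5.2 (c) (Krull's lemma) for `Λ = L` shows `1 ∈ Λ`»
(the general-`A` Krull lemma `one_mem_of_mul_le_of_mul_eq` of `FiniteQAlgebraLatticeMetricDual`); «⟸: Because of
`1 ∈ Λ`, we have `ΛΛ = Λ` (and not just `ΛΛ ⊂ Λ`)». [cite: HertlingLarabi2026, §5 Thm. 5.6 (a), chunk p0012] [cite: DadeTausskyZassenhaus1962, §1 (as cited)] -/
theorem mul_self_eq_iff_one_mem {Λ : Submodule ℤ A} (hΛ : IsFullLattice A Λ) :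
    Λ * Λ = Λ ↔ (1 : A) ∈ Λ ∧ Λ * Λ ≤ Λ :=
  ⟨fun h => ⟨one_mem_of_mul_le_of_mul_eq h.le hΛ h, h.le⟩, fun h => mul_self_eq_of_one_mem h.1 h.2⟩

/-- **THEOREM 5.6 (b) [DTZ62]: the class `[L]_ε` is an IDEMPOTENT of `𝓔(A)` (`a(LL) = L` for a unit `a`) iff it
CONTAINS AN ORDER (`1 ∈ aL`, `(aL)(aL) ⊆ aL` for a unit `a`)** («⟹: Suppose `[L]_ε[L]_ε = [L]_ε`. Then `LL ∼_ε L`, so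
`a ∈ A^{unit}` with `aLL = L` exists. Then `(aL)² = aL`, and `aL ∈ [L]_ε` is an idempotent in `𝓛(A)`. By part (a),
`aL` is an order»; «⟸: `[L]_ε[L]_ε = [Λ]_ε[Λ]_ε = [ΛΛ]_ε = [Λ]_ε = [L]_ε`»).
[cite: HertlingLarabi2026, §5 Thm. 5.6 (b), chunk p0012] [cite: DadeTausskyZassenhaus1962, §1 (as cited)] -/
theorem exists_units_smul_mul_self_eq_iff {M : Submodule ℤ A} (hM : IsFullLattice A M) :
    (∃ u : Aˣ, u • (M * M) = M) ↔ ∃ u : Aˣ, (1 : A) ∈ u • M ∧ (u • M) * (u • M) ≤ u • M := by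
  have hsq : ∀ u : Aˣ, (u • M) * (u • M) = u • (u • (M * M)) := fun u => by
    rw [units_smul_mul_units_smul, mul_smul]
  constructor
  · rintro ⟨u, hu⟩
    have hid : (u • M) * (u • M) = u • M := by rw [hsq, hu]
    exact ⟨u, (mul_self_eq_iff_one_mem (hM.units_smul u)).1 hid⟩
  · rintro ⟨u, h1, hmul⟩
    have hid : (u • M) * (u • M) = u • M := mul_self_eq_of_one_mem h1 hmul
    rw [hsq] at hid
    exact ⟨u, MulAction.injective u hid⟩

/-! ## §6 Theorem 5.6 (c) (i) ⟺ (ii) ⟺ (iv): invertibility in the semigroups `𝓛(A)` and `𝓔(A)`; `e_L = 𝒪(L)` -/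

/-- **`e_L = 𝒪(L)`: if `LL_2 = E` and `LE = L` with `E` full (Def. 4.1 (b): `L` invertible in `𝓛(A)`), then `E` is the
order `𝒪(L)`** («Then `L_2` and `Λ ∈ 𝓛(A)` with `Λ` an order and `LL_2 = Λ` and `ΛL = L` exist. The last condition
says `Λ ⊂ 𝒪(L)`. Now `LL_2 = 𝒪(L)LL_2 = 𝒪(L)Λ = 𝒪(L)` (`=` and not just `⊂` because of `1 ∈ Λ`)»; `EE = (LE)L_2 = E`
is automatic, Thm. 4.2 (a), and `E` is an order by Thm. 5.6 (a)).
[cite: HertlingLarabi2026, §5 Thm. 5.6 (c) (i) ⟹ (ii) («then `e_L = 𝒪(L)`») and §4 Def. 4.1 (b), Thm. 4.2 (a), chunks p0012, p0009] -/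
theorem eq_div_self_of_mul_eq_of_mul_eq {M L₂ E : Submodule ℤ A} (hE : IsFullLattice A E) (hML₂ : M * L₂ = E)
    (hME : M * E = M) : E = M / M := by
  -- `E` is an idempotent, hence an order
  have hEE : E * E = E := by
    calc E * E = M * L₂ * E := by rw [hML₂]
      _ = M * E * L₂ := mul_right_comm _ _ _
      _ = E := by rw [hME, hML₂]
  have h1E : (1 : A) ∈ E := ((mul_self_eq_iff_one_mem hE).1 hEE).1
  -- `E ⊆ 𝒪(L)` and `𝒪(L)E = 𝒪(L)`
  have hEO : E ≤ M / M := Submodule.le_div_iff_mul_le.2 (by rw [mul_comm, hME])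
  have hOE : (M / M) * E = M / M := by
    refine le_antisymm ?_ fun x hx => ?_
    · calc (M / M) * E ≤ (M / M) * (M / M) := mul_le_mul_right hEO _
        _ = M / M := div_self_mul_div_self M
    · rw [← mul_one x]
      exact Submodule.mul_mem_mul hx h1E
  calc E = M * L₂ := hML₂.symm
    _ = ((M / M) * M) * L₂ := by rw [div_self_mul_eq_self]
    _ = (M / M) * (M * L₂) := mul_assoc _ _ _
    _ = M / M := by rw [hML₂, hOE]

/-- **THEOREM 5.6 (c) (i) ⟺ (ii) [DTZ62]: `L` is INVERTIBLE IN THE SEMIGROUP `𝓛(A)` — Def. 4.1 (b): full lattices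
`L_2`, `E` with `LL_2 = E` and `LE = L` exist — iff `L·L_2 = 𝒪(L)` for some full lattice `L_2`** (⟹: `E = 𝒪(L)` by
`eq_div_self_of_mul_eq_of_mul_eq`; ⟸: `E = 𝒪(L)`, `L𝒪(L) = L`).
[cite: HertlingLarabi2026, §5 Thm. 5.6 (c) (i) ⟺ (ii) and §4 Def. 4.1 (b), chunks p0012, p0009] [cite: DadeTausskyZassenhaus1962, §1 (as cited)] -/
theorem exists_mul_eq_and_mul_eq_iff_exists_mul_eq_div_self {M : Submodule ℤ A} (hM : IsFullLattice A M) :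
    (∃ L₂ E : Submodule ℤ A, IsFullLattice A L₂ ∧ IsFullLattice A E ∧ M * L₂ = E ∧ M * E = M) ↔
      ∃ L₂ : Submodule ℤ A, IsFullLattice A L₂ ∧ M * L₂ = M / M := by
  constructor
  · rintro ⟨L₂, E, hL₂, hE, hML₂, hME⟩
    exact ⟨L₂, hL₂, hML₂.trans (eq_div_self_of_mul_eq_of_mul_eq hE hML₂ hME)⟩
  · rintro ⟨L₂, hL₂, hML₂⟩
    exact ⟨L₂, M / M, hL₂, isFullLattice_div hM hM, hML₂, by rw [mul_comm, div_self_mul_eq_self]⟩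

/-- **THEOREM 5.6 (c) (iv) ⟹ (ii) with `e_{[L]_ε} = [𝒪(L)]_ε`: if the class `[L]_ε` is INVERTIBLE IN `𝓔(A)` — full
`L_1`, `E` and units `a_1`, `a_2` with `a_1(LL_1) = E` (`[L]_ε[L_1]_ε = [E]_ε`) and `a_2(LE) = L`
(`[L]_ε[E]_ε = [L]_ε`) — then `aE = 𝒪(L)` for a unit `a` and `L·(aa_1L_1) = 𝒪(L)`** («Let `[L]_ε` be invertible in the
semigroup `𝓔(A)` with `e_{[L]_ε} = [Λ]_ε` with `Λ` an order. Then `[L]_ε = [L]_ε[Λ]_ε = [LΛ]_ε`, and `L_1 ∈ 𝓛(A)` with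
`[L]_ε[L_1]_ε = [Λ]_ε` exists. Thus `a ∈ A^{unit}` with `aLL_1 = Λ` exists, so `Λ ⊃ 𝒪(L)`. Now `[L]_ε = [LΛ]_ε` shows
`Λ = 𝒪(L)`»; the idempotency `a_2(EE) = E` of `[E]_ε` is automatic, and `[E]_ε` contains an order by Thm. 5.6 (b)).
[cite: HertlingLarabi2026, §5 Thm. 5.6 (c) (iv) ⟹ (i) and «`e_{[L]_ε} = [𝒪(L)]_ε`», chunk p0012] -/
theorem exists_units_smul_eq_div_self_of_units_smul_mul_eq {M L₁ E : Submodule ℤ A} {a₁ a₂ : Aˣ}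
    (hL₁ : IsFullLattice A L₁) (hE : IsFullLattice A E) (hML₁ : a₁ • (M * L₁) = E) (hME : a₂ • (M * E) = M) :
    ∃ a : Aˣ, a • E = M / M ∧ IsFullLattice A ((a * a₁) • L₁) ∧ M * ((a * a₁) • L₁) = M / M := by
  -- `[E]_ε` is an idempotent of `𝓔(A)`: `EE = a₂⁻¹E`
  have hEE' : E * E = a₂⁻¹ • E := by
    calc E * E = (a₁ • (M * L₁)) * E := by rw [hML₁]
      _ = a₁ • ((M * E) * L₁) := by rw [← units_smul_mul, mul_right_comm M L₁ E]
      _ = a₂⁻¹ • E := by rw [eq_inv_smul_iff.2 hME, ← units_smul_mul, smul_smul, mul_comm a₁, mul_smul, hML₁]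
  have hEE : a₂ • (E * E) = E := by rw [hEE', smul_inv_smul]
  -- the order `Λ = a • E` in the class of `E` (Thm. 5.6 (b))
  obtain ⟨a, h1Λ, hΛΛ⟩ := (exists_units_smul_mul_self_eq_iff hE).1 ⟨a₂, hEE⟩
  have hΛid : (a • E) * (a • E) = a • E := mul_self_eq_of_one_mem h1Λ hΛΛ
  have hΛord : (a • E) / (a • E) = a • E := div_self_eq_of_one_mem h1Λ hΛΛ
  -- `(a a₁)(L L₁) = Λ`, hence `𝒪(L) ⊆ Λ`
  have hMΛ : (a * a₁) • (M * L₁) = a • E := by rw [mul_smul, hML₁]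
  have hOle : M / M ≤ a • E := by
    have h2 : (M / M) * (a • E) = a • E := by
      rw [← hMΛ, ← units_smul_mul_right, ← mul_assoc, div_self_mul_eq_self]
    rw [← hΛord]
    exact Submodule.le_div_iff_mul_le.2 h2.le
  -- `Λ ⊆ 𝒪(LΛ) = 𝒪(a(LE)) = 𝒪(L)`
  have hΛle : a • E ≤ M / M := by
    have h3 : a • E ≤ (M * (a • E)) / (M * (a • E)) :=
      Submodule.le_div_iff_mul_le.2 (by rw [mul_left_comm, hΛid])
    have h4 : (M * (a • E)) / (M * (a • E)) = M / M := by
      have e1 : M * (a • E) = a • (M * E) := by rw [mul_comm M (a • E), ← units_smul_mul, mul_comm E M]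
      rw [e1, div_self_units_smul]
      conv_rhs => rw [← hME, div_self_units_smul]
    rwa [h4] at h3
  have hΛeq : a • E = M / M := le_antisymm hΛle hOle
  refine ⟨a, hΛeq, hL₁.units_smul _, ?_⟩
  rw [mul_comm M ((a * a₁) • L₁), ← units_smul_mul, mul_comm L₁ M, hMΛ, hΛeq]

/-- **THEOREM 5.6 (c) (iv) ⟺ (ii) [DTZ62]: the class `[L]_ε` is INVERTIBLE IN THE SEMIGROUP `𝓔(A)` — classes
`[L_1]_ε`, `[E]_ε` of full lattices with `[L]_ε[L_1]_ε = [E]_ε` and `[L]_ε[E]_ε = [L]_ε`, i.e. units `a_1, a_2` with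
`a_1(LL_1) = E`, `a_2(LE) = L` — iff `L·L_2 = 𝒪(L)` for some full lattice `L_2`** (⟸ = (ii)⟹(iii)⟹(iv) with
`a_1 = a_2 = 1`, `E = 𝒪(L)`: «`[𝒪(L)]_ε[L]_ε = [𝒪(L)L]_ε = [L]_ε`»).
[cite: HertlingLarabi2026, §5 Thm. 5.6 (c) (ii) ⟺ (iv) and §4 Def. 4.1 (b), chunks p0012, p0009] [cite: DadeTausskyZassenhaus1962, §1 (as cited)] -/
theorem exists_units_smul_mul_eq_and_iff_exists_mul_eq_div_self {M : Submodule ℤ A} (hM : IsFullLattice A M) :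
    (∃ (L₁ E : Submodule ℤ A) (a₁ a₂ : Aˣ), IsFullLattice A L₁ ∧ IsFullLattice A E ∧
        a₁ • (M * L₁) = E ∧ a₂ • (M * E) = M) ↔
      ∃ L₂ : Submodule ℤ A, IsFullLattice A L₂ ∧ M * L₂ = M / M := by
  constructor
  · rintro ⟨L₁, E, a₁, a₂, hL₁, hE, hML₁, hME⟩
    obtain ⟨a, -, hfull, h⟩ := exists_units_smul_eq_div_self_of_units_smul_mul_eq hL₁ hE hML₁ hME
    exact ⟨_, hfull, h⟩
  · rintro ⟨L₂, hL₂, hML₂⟩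
    refine ⟨L₂, M / M, 1, 1, hL₂, isFullLattice_div hM hM, ?_, ?_⟩
    · rw [one_smul, hML₂]
    · rw [one_smul, mul_comm, div_self_mul_eq_self]

/-! ## §7 Theorem 4.4 (c): `L` invertible ⟺ `[L]_w` invertible in `W(𝓛(A))` ⟺ `[L]_w` idempotent -/

/-- **THEOREM 4.4 (c) (ii) ⟹ (i) in `𝓛(A)`: if `[L]_w` is INVERTIBLE in `W(𝓛(A))` — `[L]_w[N]_w = [C]_w` and
`[C]_w[L]_w = [L]_w`, i.e. `L ∼_w LLN` for a full `N` — then `L` is invertible** («`x_1, y_1 ∈ S` with `(ab)x_1 = c`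
and `(ca)y_1 = a` exist, so `a(bx_1y_1) = cy_1` and `(cy_1)a = a`. This shows that then `a` is invertible with
`e_a = cy_1`»: here `y_1 = L:(LLN)` by Thm. 5.7 (b), `E = L(Ny_1)` is full with `LE = (LLN)y_1 = L`, so `E = 𝒪(L)` by
`eq_div_self_of_mul_eq_of_mul_eq` and `L` is invertible by Thm. 5.6 (c) (ii) ⟹ (iii)).
[cite: HertlingLarabi2026, §4 Thm. 4.4 (c) (ii) ⟹ (i) and Def. 4.1 (b), chunks p0009–p0010] -/
theorem mul_div_div_eq_of_one_mem_div_mul_mul_div {M N : Submodule ℤ A} (hM : IsFullLattice A M)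
    (hN : IsFullLattice A N) (h : (1 : A) ∈ (M / (M * M * N)) * ((M * M * N) / M)) :
    M * ((M / M) / M) = M / M := by
  -- `y_1 = L:(LLN)` with `y_1(LLN) = L`
  have h' : (1 : A) ∈ ((M * M * N) / M) * (M / (M * M * N)) := by rwa [mul_comm]
  have hY : (M / (M * M * N)) * (M * M * N) = M := div_mul_eq_of_one_mem h'
  -- the idempotent `E = L N y_1` with `LE = L`
  have hME : M * (M * (N * (M / (M * M * N)))) = M := by
    rw [← mul_assoc, ← mul_assoc, mul_comm _ (M / (M * M * N)), hY]
  have hE : IsFullLattice A (M * (N * (M / (M * M * N)))) :=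
    isFullLattice_mul hM (isFullLattice_mul hN
      (isFullLattice_div hM (isFullLattice_mul (isFullLattice_mul hM hM) hN)))
  exact mul_div_div_eq_of_exists_mul_eq_div_self ⟨_, eq_div_self_of_mul_eq_of_mul_eq hE rfl hME⟩

/-- **THEOREM 4.4 (c) (i) ⟺ (ii) in `𝓛(A)`: a full lattice `L` is invertible iff `[L]_w` is invertible in `W(𝓛(A))`,
i.e. `L ∼_w LLN` for some full `N`** (⟹ with `N = L⁻¹ = 𝒪(L):L`: `LLL⁻¹ = L𝒪(L) = L ∼_w L`).
[cite: HertlingLarabi2026, §4 Thm. 4.4 (c) (i) ⟺ (ii), chunks p0009–p0010] -/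
theorem exists_one_mem_div_mul_mul_div_iff {M : Submodule ℤ A} (hM : IsFullLattice A M) :
    (∃ N : Submodule ℤ A, IsFullLattice A N ∧ (1 : A) ∈ (M / (M * M * N)) * ((M * M * N) / M)) ↔
      M * ((M / M) / M) = M / M := by
  refine ⟨fun ⟨N, hN, h⟩ => mul_div_div_eq_of_one_mem_div_mul_mul_div hM hN h, fun hinv =>
    ⟨(M / M) / M, isFullLattice_div (isFullLattice_div hM hM) hM, ?_⟩⟩
  rw [mul_assoc, hinv, mul_comm M (M / M), div_self_mul_eq_self]
  exact one_mem_div_self_mul_div_self M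

/-- **THEOREM 4.4 (c) (i) ⟺ (iii) in `𝓛(A)`: a full lattice `L` is INVERTIBLE iff its weak class is IDEMPOTENT,
`L ∼_w LL`** (⟸: (iii) ⟹ (ii) with `N = 𝒪(L)`, `LL𝒪(L) = LL`; ⟹: «Because of (b), `[a]_w = [e_a]_w`. Because of (a),
`[e_a]_w² = [e_a²]_w = [e_a]_w`» — here directly `L⁻¹(LL) = 𝒪(L)L = L`, `1 ∈ L⁻¹L`).
[cite: HertlingLarabi2026, §4 Thm. 4.4 (c) (i) ⟺ (iii), chunks p0009–p0010] -/
theorem one_mem_div_mul_self_mul_div_iff {M : Submodule ℤ A} (hM : IsFullLattice A M) :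
    (1 : A) ∈ (M / (M * M)) * ((M * M) / M) ↔ M * ((M / M) / M) = M / M := by
  constructor
  · intro h
    refine mul_div_div_eq_of_one_mem_div_mul_mul_div (N := M / M) hM (isFullLattice_div hM hM) ?_
    rwa [mul_assoc, mul_comm M (M / M), div_self_mul_eq_self]
  · intro hinv
    refine one_mem_div_mul_div_of_eq_mul (P := (M / M) / M) (Q := M) ?_ rfl ?_
    · rw [← mul_assoc, mul_comm ((M / M) / M) M, hinv, div_self_mul_eq_self]
    · rw [mul_comm, hinv]; exact one_mem_div_self M

end Semigroup

end Literature.NumberTheory.ComplexMultiplication.FiniteQAlgebraLattice
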